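import Mathlib
import Literature.Computability.AlgebraicComplexity.BurgisserBooleanParts
import Literature.Computability.AlgebraicComplexity.ArithCircuit
import Summits.ValiantsHypothesis.ValiantsHypothesis.Theorems.NumTameDefs
import HarnessLib

/-!
# Route NumTame — crux `TameA3` (stmt-ValiantsHypothesis-5386), towards stub `stub_rounding`:
# arithmetic of the clamped fixed-point format and the one-step error bounds

First of two files proving registered stub 1 (`stub_rounding`, "ERROR RECURSION") of the crux line
`Cruxes/TameA3/Lines/birth.lean` over the `FixedPoint` definitions (`NumTameDefs.lean`, re-homed
verbatim from the skeleton by the line lead val-lit-p6 g7). With `δ = 2^{-B}`, `M = 2^R`, `K = 2^{R+2} + 8`: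
* format arithmetic: constants round to within `δ` (`norm_ofComplex_sub_le`) and stay in range
  (`clamp_ofComplex`); the arithmetic shift truncates by `≤ 2δ` (`norm_rshift_sub_le`) and is exact
  on `2^B · z` (`rshift_two_pow_mul`); a value of scaled norm `< 2^I` is not clamped
  (`clamp_eq_self_of_norm_lt`);
* one step of the run: operands are tracked to within `η + δ` (`operandFx_error`) and each term of
  a sum gate to within `M(η+δ) + δ(M+3)` (`sumTerm_error`), the clamps being idle as long as
  `η + δ ≤ 1`.
The one-gate bound `K(η + δ)` (`gateFx_error`), the induction along the gate list and the stub itself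
are in `NumTameTameA3Rounding.lean`.

Honest framing: infrastructure for one stub of a crux of a conditional route (NumTame);
`VP ≠ VNP` is NOT proved and nothing here is progress on it.

## References

* P. Bürgisser, *Cook's versus Valiant's hypothesis*, Theoret. Comput. Sci. 235 (2000), §5 (A3).
  [cite: Burgisser2000TCS, §5 (A3)]
* P. Koiran, *A weak version of the Blum–Shub–Smale model*, JCSS 54 (1997); L. Blum, F. Cucker,
  M. Shub, S. Smale, *Complexity and Real Computation* (1998) (bit-model simulation with rounding).
-/

set_option linter.dupNamespace false

noncomputable section

open MvPolynomial

/-! ## Part 1 — arithmetic of the fixed-point format -/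

namespace Summit.ValiantsHypothesis.ValiantsHypothesis.Theorems.NumTame

open Literature.Computability.AlgebraicComplexity ArithCircuit FixedPoint

/-! ### Gaussian integers read as complex numbers at scale `2^B` -/

/-- `2^B` in `ℂ` is the real number `2^B`. [folklore] -/
theorem two_pow_complex_eq (B : ℕ) : ((2 : ℂ) ^ B) = (((2 : ℝ) ^ B : ℝ) : ℂ) := by
  push_cast; rfl

/-- Real part of a scaled Gaussian integer. [folklore] -/
theorem re_div_two_pow (z : GaussianInt) (B : ℕ) :
    ((z : ℂ) / (2 : ℂ) ^ B).re = (z.re : ℝ) / (2 : ℝ) ^ B := by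
  rw [two_pow_complex_eq, Complex.div_ofReal_re, ← GaussianInt.intCast_re]

/-- Imaginary part of a scaled Gaussian integer. [folklore] -/
theorem im_div_two_pow (z : GaussianInt) (B : ℕ) :
    ((z : ℂ) / (2 : ℂ) ^ B).im = (z.im : ℝ) / (2 : ℝ) ^ B := by
  rw [two_pow_complex_eq, Complex.div_ofReal_im, ← GaussianInt.intCast_im]

/-- Components of a complex number of norm `< 2^I · 2^B`… concretely: if `‖z / 2^B‖ < 2^I` then both
components of the Gaussian integer `z` have absolute value `< 2^(I+B)`. [folklore] -/
theorem abs_re_im_lt_of_norm_lt {z : GaussianInt} {I B : ℕ}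
    (h : ‖(z : ℂ) / (2 : ℂ) ^ B‖ < (2 : ℝ) ^ I) :
    |z.re| < 2 ^ (I + B) ∧ |z.im| < 2 ^ (I + B) := by
  have hB : (0 : ℝ) < (2 : ℝ) ^ B := by positivity
  have hnorm : ‖(z : ℂ)‖ < (2 : ℝ) ^ (I + B) := by
    have : ‖(z : ℂ) / (2 : ℂ) ^ B‖ = ‖(z : ℂ)‖ / (2 : ℝ) ^ B := by
      rw [norm_div, norm_pow, Complex.norm_ofNat]
    rw [this, div_lt_iff₀ hB] at h
    rwa [pow_add]
  have hre : |((z : ℂ)).re| < (2 : ℝ) ^ (I + B) := (Complex.abs_re_le_norm _).trans_lt hnorm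
  have him : |((z : ℂ)).im| < (2 : ℝ) ^ (I + B) := (Complex.abs_im_le_norm _).trans_lt hnorm
  rw [← GaussianInt.intCast_re] at hre
  rw [← GaussianInt.intCast_im] at him
  exact ⟨by exact_mod_cast hre, by exact_mod_cast him⟩

/-- The clamp is idle on a value whose scaled norm is `< 2^I`. [folklore] -/
theorem clamp_eq_self_of_norm_lt {I B : ℕ} {z : GaussianInt}
    (h : ‖(z : ℂ) / (2 : ℂ) ^ B‖ < (2 : ℝ) ^ I) : clamp (I + B) z = z :=
  clamp_eq_self (abs_re_im_lt_of_norm_lt h).1 (abs_re_im_lt_of_norm_lt h).2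

/-! ### Rounding of constants -/

/-- **Constants are rounded to within `2^{-B}`**: `‖ofComplex B a / 2^B − a‖ ≤ 1/2^B`. [folklore] -/
theorem norm_ofComplex_sub_le (B : ℕ) (a : ℂ) :
    ‖((ofComplex B a : GaussianInt) : ℂ) / (2 : ℂ) ^ B - a‖ ≤ 1 / (2 : ℝ) ^ B := by
  have hB : (0 : ℝ) < (2 : ℝ) ^ B := by positivity
  refine (Complex.norm_le_abs_re_add_abs_im _).trans ?_
  have hre : |(((ofComplex B a : GaussianInt) : ℂ) / (2 : ℂ) ^ B - a).re| ≤ 1 / 2 / (2 : ℝ) ^ B := by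
    rw [Complex.sub_re, re_div_two_pow]
    change |((round (a.re * 2 ^ B) : ℤ) : ℝ) / 2 ^ B - a.re| ≤ _
    rw [show ((round (a.re * 2 ^ B) : ℤ) : ℝ) / 2 ^ B - a.re =
        (((round (a.re * 2 ^ B) : ℤ) : ℝ) - a.re * 2 ^ B) / 2 ^ B by field_simp]
    rw [abs_div, abs_of_pos hB, div_le_div_iff_of_pos_right hB, abs_sub_comm]
    exact abs_sub_round _
  have him : |(((ofComplex B a : GaussianInt) : ℂ) / (2 : ℂ) ^ B - a).im| ≤ 1 / 2 / (2 : ℝ) ^ B := by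
    rw [Complex.sub_im, im_div_two_pow]
    change |((round (a.im * 2 ^ B) : ℤ) : ℝ) / 2 ^ B - a.im| ≤ _
    rw [show ((round (a.im * 2 ^ B) : ℤ) : ℝ) / 2 ^ B - a.im =
        (((round (a.im * 2 ^ B) : ℤ) : ℝ) - a.im * 2 ^ B) / 2 ^ B by field_simp]
    rw [abs_div, abs_of_pos hB, div_le_div_iff_of_pos_right hB, abs_sub_comm]
    exact abs_sub_round _
  calc _ ≤ 1 / 2 / (2 : ℝ) ^ B + 1 / 2 / (2 : ℝ) ^ B := add_le_add hre him
    _ = 1 / (2 : ℝ) ^ B := by ring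

/-- A constant of modulus `≤ 2^R` rounds into the format `(R+2, B)` (the clamp is idle). [folklore] -/
theorem clamp_ofComplex {R B : ℕ} {a : ℂ} (ha : ‖a‖ ≤ (2 : ℝ) ^ R) :
    clamp (R + 2 + B) (ofComplex B a) = ofComplex B a := by
  apply clamp_eq_self_of_norm_lt
  have h1 := norm_ofComplex_sub_le B a
  have hδ : 1 / (2 : ℝ) ^ B ≤ 1 := by
    rw [div_le_one (by positivity)]; exact one_le_pow₀ (by norm_num)
  have hR : (1 : ℝ) ≤ 2 ^ R := one_le_pow₀ (by norm_num)
  calc ‖((ofComplex B a : GaussianInt) : ℂ) / (2 : ℂ) ^ B‖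
      ≤ ‖((ofComplex B a : GaussianInt) : ℂ) / (2 : ℂ) ^ B - a‖ + ‖a‖ := norm_le_norm_sub_add _ _
    _ ≤ 1 + 2 ^ R := add_le_add (h1.trans hδ) ha
    _ < 2 ^ (R + 2) := by rw [pow_add]; nlinarith

/-! ### The arithmetic shift -/

/-- Floor division by `2^B` in `ℤ`, read in `ℝ`: `0 ≤ m/2^B − ⌊m/2^B⌋ < 1`. [folklore] -/
theorem ediv_two_pow_bounds (m : ℤ) (B : ℕ) :
    ((m / 2 ^ B : ℤ) : ℝ) ≤ (m : ℝ) / 2 ^ B ∧ (m : ℝ) / 2 ^ B < ((m / 2 ^ B : ℤ) : ℝ) + 1 := by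
  have hd : (0 : ℤ) < 2 ^ B := by positivity
  have hdr : (0 : ℝ) < ((2 ^ B : ℤ) : ℝ) := by exact_mod_cast hd
  have h1 := Int.emod_add_mul_ediv m (2 ^ B)    -- m % 2^B + 2^B * (m / 2^B) = m
  have h2 := Int.emod_nonneg m hd.ne'
  have h3 := Int.emod_lt_of_pos m hd
  have hm : (m : ℝ) = ((m % 2 ^ B : ℤ) : ℝ) + ((2 ^ B : ℤ) : ℝ) * ((m / 2 ^ B : ℤ) : ℝ) := by
    exact_mod_cast h1.symm
  have h2r : (0 : ℝ) ≤ ((m % 2 ^ B : ℤ) : ℝ) := by exact_mod_cast h2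
  have h3r : ((m % 2 ^ B : ℤ) : ℝ) < ((2 ^ B : ℤ) : ℝ) := by exact_mod_cast h3
  have hcast : ((2 ^ B : ℤ) : ℝ) = (2 : ℝ) ^ B := by push_cast; rfl
  rw [hcast] at hm h3r hdr
  constructor
  · rw [le_div_iff₀ hdr, hm]; nlinarith
  · rw [div_lt_iff₀ hdr, hm]; nlinarith

/-- **Truncation error of the arithmetic shift**: `‖rshift B z / 2^B − z / 2^{2B}‖ ≤ 2/2^B`. [folklore] -/
theorem norm_rshift_sub_le (B : ℕ) (z : GaussianInt) :
    ‖((rshift B z : GaussianInt) : ℂ) / (2 : ℂ) ^ B - (z : ℂ) / (2 : ℂ) ^ B / (2 : ℂ) ^ B‖ ≤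
      2 / (2 : ℝ) ^ B := by
  have hB : (0 : ℝ) < (2 : ℝ) ^ B := by positivity
  refine (Complex.norm_le_abs_re_add_abs_im _).trans ?_
  have hcomp : ∀ m : ℤ, |((m / 2 ^ B : ℤ) : ℝ) / 2 ^ B - (m : ℝ) / 2 ^ B / 2 ^ B| ≤ 1 / (2 : ℝ) ^ B := by
    intro m
    obtain ⟨h1, h2⟩ := ediv_two_pow_bounds m B
    rw [show ((m / 2 ^ B : ℤ) : ℝ) / 2 ^ B - (m : ℝ) / 2 ^ B / 2 ^ B =
      (((m / 2 ^ B : ℤ) : ℝ) - (m : ℝ) / 2 ^ B) / 2 ^ B by ring, abs_div, abs_of_pos hB,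
      div_le_div_iff_of_pos_right hB, abs_le]
    constructor <;> linarith
  have hre : |((((rshift B z : GaussianInt) : ℂ) / (2 : ℂ) ^ B - (z : ℂ) / (2 : ℂ) ^ B / (2 : ℂ) ^ B)).re|
      ≤ 1 / (2 : ℝ) ^ B := by
    rw [Complex.sub_re, re_div_two_pow, two_pow_complex_eq, Complex.div_ofReal_re,
      Complex.div_ofReal_re, ← GaussianInt.intCast_re z]
    exact hcomp z.re
  have him : |((((rshift B z : GaussianInt) : ℂ) / (2 : ℂ) ^ B - (z : ℂ) / (2 : ℂ) ^ B / (2 : ℂ) ^ B)).im|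
      ≤ 1 / (2 : ℝ) ^ B := by
    rw [Complex.sub_im, im_div_two_pow, two_pow_complex_eq, Complex.div_ofReal_im,
      Complex.div_ofReal_im, ← GaussianInt.intCast_im z]
    exact hcomp z.im
  calc _ ≤ 1 / (2 : ℝ) ^ B + 1 / (2 : ℝ) ^ B := add_le_add hre him
    _ = 2 / (2 : ℝ) ^ B := by ring

/-- `2^B` as a Gaussian integer has components `(2^B, 0)`. [folklore] -/
theorem two_pow_gaussianInt_re_im (B : ℕ) :
    ((2 : GaussianInt) ^ B).re = 2 ^ B ∧ ((2 : GaussianInt) ^ B).im = 0 := by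
  have : ((2 : GaussianInt) ^ B) = (((2 ^ B : ℕ) : ℤ) : GaussianInt) := by push_cast; rfl
  rw [this, Zsqrtd.re_intCast, Zsqrtd.im_intCast]
  exact ⟨by push_cast; rfl, rfl⟩

/-- Shifting `2^B · z` back by `B` bits is exact. [folklore] -/
theorem rshift_two_pow_mul (B : ℕ) (z : GaussianInt) : rshift B (2 ^ B * z) = z := by
  obtain ⟨hre, him⟩ := two_pow_gaussianInt_re_im B
  have hd : (2 : ℤ) ^ B ≠ 0 := by positivity
  unfold rshift
  ext
  · simp only [Zsqrtd.re_mul, hre, him, zero_mul, mul_zero, add_zero]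
    exact Int.mul_ediv_cancel_left _ hd
  · simp only [Zsqrtd.im_mul, hre, him, zero_mul, add_zero]
    exact Int.mul_ediv_cancel_left _ hd

/-- The unit `2^B` of the format, read at scale `2^B`, is `1`. [folklore] -/
theorem toComplex_two_pow_div (B : ℕ) : (((2 : GaussianInt) ^ B : GaussianInt) : ℂ) / (2 : ℂ) ^ B = 1 := by
  rw [map_pow, map_ofNat, div_self (pow_ne_zero _ two_ne_zero)]

/-- The unit `2^B` lies in every format `(I+B)` with `I ≥ 1`. [folklore] -/
theorem clamp_two_pow (I B : ℕ) (hI : 1 ≤ I) : clamp (I + B) ((2 : GaussianInt) ^ B) = 2 ^ B := by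
  obtain ⟨hre, him⟩ := two_pow_gaussianInt_re_im B
  refine clamp_eq_self ?_ ?_
  · rw [hre, abs_of_pos (by positivity)]
    exact pow_lt_pow_right₀ (by norm_num) (by omega)
  · rw [him]; positivity

end Summit.ValiantsHypothesis.ValiantsHypothesis.Theorems.NumTame


/-! ## Part 2 — one step of the clamped fixed-point run: operands and gates -/

namespace Summit.ValiantsHypothesis.ValiantsHypothesis.Theorems.NumTame

open Literature.Computability.AlgebraicComplexity ArithCircuit FixedPoint

/-- `‖pq − ab‖ ≤ ‖p − a‖‖q‖ + ‖a‖‖q − b‖`. [folklore] -/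
theorem norm_mul_sub_mul_le' (p q a b : ℂ) : ‖p * q - a * b‖ ≤ ‖p - a‖ * ‖q‖ + ‖a‖ * ‖q - b‖ := by
  have : p * q - a * b = (p - a) * q + a * (q - b) := by ring
  rw [this]
  exact (norm_add_le _ _).trans (by rw [norm_mul, norm_mul])

/-- Products of Gaussian integers at scale `2^B`: `(zw)/2^B/2^B = (z/2^B)(w/2^B)`. [folklore] -/
theorem toComplex_mul_div (z w : GaussianInt) (B : ℕ) :
    (((z * w : GaussianInt)) : ℂ) / (2 : ℂ) ^ B / (2 : ℂ) ^ B =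
      ((z : ℂ) / (2 : ℂ) ^ B) * ((w : ℂ) / (2 : ℂ) ^ B) := by
  rw [GaussianInt.toComplex_mul]
  ring

section Step

variable {σ : Type*} (x : σ → Bool) (R B : ℕ) (vals : List (MvPolynomial σ ℂ))
  (fx : List GaussianInt) (η : ℝ)

/-- **Operands of the fixed-point run track the exact operands.** If every stored fixed-point gate
value is within `η` of the exact gate value (and the exact gate values have modulus `≤ 2^R`), then an
operand with constant of modulus `≤ 2^R` is evaluated to within `η + 2^{-B}`, and its exact value has
modulus `≤ 2^R` (variables are `0/1`, constants are rounded, junk references read `0` on both sides).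
[folklore] -/
theorem operandFx_error (hlen : fx.length = vals.length) (hη : 0 ≤ η)
    (herr : ∀ (i : ℕ) (hi : i < fx.length),
      ‖(fx[i] : ℂ) / (2 : ℂ) ^ B - eval (boolPoint ℂ x) (vals[i]'(hlen ▸ hi))‖ ≤ η)
    (hvals : ∀ v ∈ vals, ‖eval (boolPoint ℂ x) v‖ ≤ (2 : ℝ) ^ R)
    (u : Operand ℂ σ) (hu : ∀ a, u = Operand.const a → ‖a‖ ≤ (2 : ℝ) ^ R) :
    ‖((operandFx (R + 2) B x fx u : GaussianInt) : ℂ) / (2 : ℂ) ^ B -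
        eval (boolPoint ℂ x) (u.eval vals)‖ ≤ η + 1 / (2 : ℝ) ^ B ∧
      ‖eval (boolPoint ℂ x) (u.eval vals)‖ ≤ (2 : ℝ) ^ R := by
  have hδ : (0 : ℝ) ≤ 1 / (2 : ℝ) ^ B := by positivity
  have hR : (1 : ℝ) ≤ (2 : ℝ) ^ R := one_le_pow₀ (by norm_num)
  cases u with
  | var i =>
    simp only [operandFx, Operand.eval, eval_X, boolPoint_apply]
    by_cases hx : x i
    · simp only [hx, if_true]
      rw [clamp_two_pow (R + 2) B (by omega), toComplex_two_pow_div]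
      refine ⟨by simpa using add_nonneg hη hδ, by simpa using hR⟩
    · simp only [hx, Bool.false_eq_true, if_false, map_zero, zero_div, sub_zero, norm_zero]
      exact ⟨add_nonneg hη hδ, by positivity⟩
  | const a =>
    simp only [operandFx, Operand.eval, eval_C]
    rw [clamp_ofComplex (hu a rfl)]
    exact ⟨(norm_ofComplex_sub_le B a).trans (by linarith), hu a rfl⟩
  | gate j =>
    simp only [operandFx, Operand.eval, List.getD_eq_getElem?_getD]
    by_cases hj : j < fx.length
    · have hj' : j < vals.length := hlen ▸ hj
      rw [List.getElem?_eq_getElem hj, List.getElem?_eq_getElem hj']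
      simp only [Option.getD_some]
      exact ⟨(herr j hj).trans (by linarith), hvals _ (List.getElem_mem hj')⟩
    · have hj' : ¬ j < vals.length := hlen ▸ hj
      rw [List.getElem?_eq_none (not_lt.mp hj), List.getElem?_eq_none (not_lt.mp hj')]
      simp only [Option.getD_none, map_zero, zero_div, sub_zero, norm_zero]
      exact ⟨add_nonneg hη hδ, by positivity⟩

/-- One summand of a sum gate: `rshift B (ŵ · û)` tracks `w · u` to within
`2^R (η + δ) + δ (2^R + 3)`, `δ = 2^{-B}`. [folklore] -/
theorem sumTerm_error (hlen : fx.length = vals.length) (hη : 0 ≤ η) (hη1 : η + 1 / (2 : ℝ) ^ B ≤ 1)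
    (herr : ∀ (i : ℕ) (hi : i < fx.length),
      ‖(fx[i] : ℂ) / (2 : ℂ) ^ B - eval (boolPoint ℂ x) (vals[i]'(hlen ▸ hi))‖ ≤ η)
    (hvals : ∀ v ∈ vals, ‖eval (boolPoint ℂ x) v‖ ≤ (2 : ℝ) ^ R)
    (a : ℂ × Operand ℂ σ) (ha : ‖a.1‖ ≤ (2 : ℝ) ^ R)
    (hu : ∀ c, a.2 = Operand.const c → ‖c‖ ≤ (2 : ℝ) ^ R) :
    ‖((rshift B (clamp (R + 2 + B) (ofComplex B a.1) * operandFx (R + 2) B x fx a.2) : GaussianInt) : ℂ) /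
          (2 : ℂ) ^ B - eval (boolPoint ℂ x) (a.1 • a.2.eval vals)‖ ≤
      (2 : ℝ) ^ R * (η + 1 / (2 : ℝ) ^ B) + 1 / (2 : ℝ) ^ B * ((2 : ℝ) ^ R + 3) := by
  set δ : ℝ := 1 / (2 : ℝ) ^ B with hδdef
  have hδ : 0 ≤ δ := by positivity
  obtain ⟨hue, hun⟩ := operandFx_error x R B vals fx η hlen hη herr hvals a.2 hu
  rw [clamp_ofComplex ha]
  set W : GaussianInt := ofComplex B a.1
  set U : GaussianInt := operandFx (R + 2) B x fx a.2
  set w' : ℂ := (W : ℂ) / (2 : ℂ) ^ B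
  set u' : ℂ := (U : ℂ) / (2 : ℂ) ^ B
  set u : ℂ := eval (boolPoint ℂ x) (a.2.eval vals)
  have hw : ‖w' - a.1‖ ≤ δ := norm_ofComplex_sub_le B a.1
  have hsh := norm_rshift_sub_le B (W * U)
  rw [toComplex_mul_div] at hsh
  have hprod : ‖w' * u' - a.1 * u‖ ≤ δ * ((2 : ℝ) ^ R + 1) + (2 : ℝ) ^ R * (η + δ) := by
    refine (norm_mul_sub_mul_le' w' u' a.1 u).trans ?_
    have hu'n : ‖u'‖ ≤ (2 : ℝ) ^ R + 1 :=
      calc ‖u'‖ ≤ ‖u' - u‖ + ‖u‖ := norm_le_norm_sub_add _ _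
        _ ≤ (η + δ) + (2 : ℝ) ^ R := add_le_add hue hun
        _ ≤ (2 : ℝ) ^ R + 1 := by linarith
    gcongr
  rw [smul_eval]
  calc ‖((rshift B (W * U) : GaussianInt) : ℂ) / (2 : ℂ) ^ B - a.1 * u‖
      ≤ ‖((rshift B (W * U) : GaussianInt) : ℂ) / (2 : ℂ) ^ B - w' * u'‖ + ‖w' * u' - a.1 * u‖ :=
        norm_sub_le_norm_sub_add_norm_sub _ _ _
    _ ≤ 2 / (2 : ℝ) ^ B + (δ * ((2 : ℝ) ^ R + 1) + (2 : ℝ) ^ R * (η + δ)) := add_le_add hsh hprod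
    _ = (2 : ℝ) ^ R * (η + δ) + δ * ((2 : ℝ) ^ R + 3) := by rw [hδdef]; ring

end Step

end Summit.ValiantsHypothesis.ValiantsHypothesis.Theorems.NumTame

end
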